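import Summits.QuantumFields.QCD.Theorems.QuarksAsStableActionStableActionBridgeFockLiftPosDef

/-!
# The supertrace formula `STr Γ(X) = det(1 − X)` for the Fock-space functor `fockLift`
(helper for crux stmt-QuantumFields-9737, line `Sketch` — stubs `fockLift_neg_apply`,
`det_one_sub_eq_supertrace_fockLift` of Lüscher's transfer-matrix formalism for lattice QCD with
Wilson quarks)

`fockLift X = Γ(X)` (`QCDTransferMatrix`) is the second-quantisation (matrix-of-minors) functor on
the fermionic Fock space `Fock ι = Finset ι → ℂ`:
`⟨s|Γ(X)|t⟩ = det X[s,t]` (increasing enumerations), `0` off the particle-number diagonal. The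
tree's `FockLiftPosDef.trace_fockLift` is the ANTIPERIODIC trace formula `Tr Γ(X) = det(1 + X)`;
the time-PERIODIC Wilson operator of the crux statement produces `det(1 − X)` instead, which is
the SUPERTRACE `STr Γ(X) = Σ_s (−1)^{#s} Γ(X)_{ss}` (fermion number grading `(−1)^F`).

* `fockLift_neg_apply`: `Γ(−X)_{s,t} = (−1)^{#s} Γ(X)_{s,t}` — the `#s × #s` minor of `−X` is
  `det(−Y) = (−1)^{#s} det Y` (`Matrix.det_neg`); off the particle-number diagonal both sides
  vanish.
* `det_one_sub_eq_supertrace_fockLift`: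
  `det(1 − X) = det(1 + (−X)) = Tr Γ(−X) = Σ_s (−1)^{#s} Γ(X)_{ss}`.

Both are classical facts about compound matrices / free-fermion traces
([cite: Luscher1977, §3]; [cite: Smit2023, App. C (C.62)–(C.70)]). Pure theorem file (no
definitions).
-/

namespace Summit.QuantumFields.QCD.Cruxes.StableActionBridge.Sketch

open MeasureTheory Matrix Literature.MathematicalPhysics.QuantumFieldTheory
  Literature.MathematicalPhysics.QuantumLattice

namespace Supertrace

/-- `Γ(−X)_{s,t} = (−1)^{#s} Γ(X)_{s,t}` for an index type in any universe (no finiteness needed):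
the minor of `−X` on rows `s`, columns `t` (`#t = #s`) is `det(−Y) = (−1)^{#s} det Y`; if `#t ≠ #s`
both entries are `0`. [folklore] -/
theorem fockLift_neg_apply' {ι : Type*} [LinearOrder ι] (X : Matrix ι ι ℂ) (s t : Finset ι) :
    fockLift (-X) s t = (-1 : ℂ) ^ s.card * fockLift X s t := by
  by_cases h : t.card = s.card
  · rw [fockLift, fockLift, Matrix.of_apply, Matrix.of_apply, dif_pos h, dif_pos h,
      Matrix.submatrix_neg, Pi.neg_apply, Pi.neg_apply, Matrix.det_neg, Fintype.card_fin]
  · rw [fockLift, fockLift, Matrix.of_apply, Matrix.of_apply, dif_neg h, dif_neg h, mul_zero]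

/-- **Supertrace formula** `det(1 − X) = Σ_s (−1)^{#s} Γ(X)_{ss}` (universe-polymorphic form of the
registered `det_one_sub_eq_supertrace_fockLift`): `det(1 − X) = det(1 + (−X)) = Tr Γ(−X)`
(`trace_fockLift`) and `Γ(−X)_{ss} = (−1)^{#s} Γ(X)_{ss}` (`fockLift_neg_apply'`). [folklore] -/
theorem det_one_sub_eq_supertrace_fockLift' {ι : Type*} [LinearOrder ι] [Fintype ι]
    (X : Matrix ι ι ℂ) : (1 - X).det = ∑ s : Finset ι, (-1 : ℂ) ^ s.card * fockLift X s s := by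
  rw [sub_eq_add_neg, ← FockLiftPosDef.trace_fockLift, Matrix.trace]
  exact Finset.sum_congr rfl fun s _ => fockLift_neg_apply' X s s

end Supertrace

/-- **`Γ(−X) = (−1)^F Γ(X)` entrywise**: `fockLift (−X) s t = (−1)^{#s} · fockLift X s t` (the
`#s × #s` minor of `−X` is `(−1)^{#s}` times that of `X`; both sides vanish when `#t ≠ #s`).
Registered sub-goal of crux stmt-QuantumFields-9737, line `Sketch`. [folklore] -/
theorem fockLift_neg_apply :
    ∀ (ι : Type) [LinearOrder ι] [Fintype ι] (X : Matrix ι ι ℂ) (s t : Finset ι),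
      fockLift (-X) s t = (-1 : ℂ) ^ s.card * fockLift X s t :=
  fun _ _ _ X s t => Supertrace.fockLift_neg_apply' X s t

/-- **The periodic (supertrace) free-fermion formula**
`det(1 − X) = STr Γ(X) = Σ_s (−1)^{#s} Γ(X)_{ss}`, companion of the antiperiodic
`Tr Γ(X) = det(1 + X)` (`FockLiftPosDef.trace_fockLift`).
Registered sub-goal of crux stmt-QuantumFields-9737, line `Sketch`. [folklore] -/
theorem det_one_sub_eq_supertrace_fockLift :
    ∀ (ι : Type) [LinearOrder ι] [Fintype ι] (X : Matrix ι ι ℂ),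
      (1 - X).det = ∑ s : Finset ι, (-1 : ℂ) ^ s.card * fockLift X s s :=
  fun _ _ _ X => Supertrace.det_one_sub_eq_supertrace_fockLift' X

end Summit.QuantumFields.QCD.Cruxes.StableActionBridge.Sketch
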